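import Summits.HodgeConjecture.HodgeConjecture.Theorems.PadicSemiregularLiftAbelianAnchorAssemblyLowDimension
import Summits.HodgeConjecture.HodgeConjecture.Theorems.PadicSemiregularLiftAbelianAnchorAssemblyGlue
import Literature.AlgebraicGeometry.HodgeTheory.ComplexConjugationHolds

/-!
# `AbelianAnchorAssembly` (stmt-HodgeConjecture-14913) — Hodge-model hypothesis discharged, and the dimension-six threshold of its children

Route `PadicSemiregularLift`, support item (abelian anchor-class glue node)
`AbelianAnchorAssembly := HodgeLocusPropagation → FormalLiftingFromClassLifting →
FormalVectorBundlesAlgebraize → HodgeAbelianVarieties`.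

Two sharpenings of what is landed for the node (`…AbelianAnchorAssembly.lean` p89354,
`…AbelianAnchorAssemblyGlue.lean` p89488, `…AbelianAnchorAssemblyLowDimension.lean` p95194):

1. **The Hodge-model hypothesis is a theorem.** Every landed statement about the node carries
   `hM : ∀ n X, nonempty_hodgeModel n X` (= route item `AnchorTransport.HodgeModels`, stmt-1943). That fact is
   DISCHARGED in the tree — `Literature.AlgebraicGeometry.HodgeTheory.nonempty_hodgeModel_holds`
   (`HodgeTheory/ComplexConjugationHolds`; axioms `propext, Classical.choice, Quot.sound`) — so here the glue of
   the foreseen split takes EXACTLY its two children (`abelianAnchorAssembly_of_children`), the node's logical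
   status is stated without `hM` (`hodgeAbelianVarieties_iff_cyclePart`,
   `abelianAnchorAssembly_iff_middleCyclePart_of_engine'`, `abelianAnchorAssembly_iff_dim_ge_six_of_engine'`,
   `abelianAnchorAssembly_of_dim_ge_six'`), and the Hodge conjecture for complex abelian varieties of
   dimension `≤ 1` is an UNCONDITIONAL theorem of the tree (`hodgeConjectureFor_abelian_of_dim_le_one`).
2. **Dimension threshold for the children.** The composition is pointwise in the abelian variety
   (`hodgeConjectureFor_of_innerFormAnchorsFor`: one inner-form anchor of `A` + rational pVHC at the genuine
   anchors of dimension `A.dim` + P2c ⟹ `HodgeConjectureFor A.dim A.X`), so below any threshold `m` settled in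
   print the children are idle: with Markman's Cor. 1.3 (`dim ≤ 5`, Literature fact) the node follows from
   inner-form anchors of abelian varieties of dimension `≥ 6` and (⋆)-seeds on supersingular abelian-scheme
   models of RELATIVE DIMENSION `≥ 6` only (`abelianAnchorAssembly_of_children_dim_ge_six`; engine-free form
   `hodgeAbelianVarieties_of_rationalPVHC_dim_ge`). This is the exact residual the planner's split items
   `AbelianInnerFormAnchors` / `AbelianStarSeeds` need to carry.

Everything conditional is conditional on route items / route-posited predicates / the Markman fact taken
as hypotheses (D-0014); nothing asserts a Theses declaration unconditionally except the `dim ≤ 1` instance,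
which is proved.
-/

-- `Summit.HodgeConjecture.HodgeConjecture.…` is the tree's mandated summit/problem namespace (single-problem summit):
-- the duplicated component is by design (CONVENTIONS §1), so the dupNamespace linter is silenced for this file.
set_option linter.dupNamespace false

noncomputable section

open CategoryTheory AlgebraicGeometry
open Literature.AlgebraicGeometry Literature.AlgebraicGeometry.Motives
  Literature.AlgebraicGeometry.HodgeTheory Literature.AlgebraicGeometry.Crystalline
  Literature.AlgebraicTopology.SingularHomology
open Literature.AlgebraicGeometry.Crystalline.PadicAnchor

namespace Summit.HodgeConjecture.HodgeConjecture.Theorems.PadicSemiregularLift.AbelianAnchor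

open Summit.HodgeConjecture.HodgeConjecture.Theses.PadicSemiregularLift

/-! ### The composition, pointwise in the abelian variety -/

/-- **HC for ONE complex abelian variety from ONE inner-form anchor** (the glue's composition
`hodgeAbelianVarieties_of_rationalPVHC`, p89488, localised at `A` and with the Hodge-model conjunct
discharged): an inner-form anchor of `A` — a `ℚ̄`-family through `A ≅ 𝒳_t` with global Hodge classes and a
`ℚ̄`-generic point `s` whose fibre carries a genuine spanning supersingular anchor —, rational pVHC in the
middle degrees at every GENUINE anchor of dimension `A.dim`, and P2c `HodgeLocusPropagation` (by name) give
`HodgeConjectureFor A.dim A.X`: `cyclePart` on the fibre at `s`, propagation `s ↦ t` (P2c), transport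
across `A.X ≅ 𝒳_t` (`anchorTransport_isoInvariance_proof`, PROVED). [cite: Deligne2000, §1] -/
theorem hodgeConjectureFor_of_innerFormAnchorsFor (A : AbelianVariety ℂ) (h₁ : InnerFormAnchorsFor A)
    (hR : ∀ ⦃X : SchemeOver ℂ⦄ (D : Anchor A.dim X), D.IsGenuine → RationalPVHCFor D.C A.dim D.𝒴)
    (hP : HodgeLocusPropagation) : HodgeConjectureFor A.dim A.X := by
  refine (hodgeConjectureFor_iff_of_isSmoothProjective nonempty_hodgeModel_holds
    (AbelianVariety.isSmoothProjective_holds (A := A))).2 ?_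
  intro p c hc hH
  obtain ⟨σ, 𝒳₀, S₀, f₀, t, s, eA, hqp, hirr, hfam, hgen, hext, D, hD, hS⟩ := h₁
  obtain ⟨𝔄, h𝔄c, h𝔄rat, h𝔄hodge⟩ := hext p c hc hH
  -- HC (cycle part) on the anchored fibre `𝒳_s`: spanning + rational pVHC + genuineness
  have hs : complexBetti.map (fiberι ((baseChangeHom σ).map f₀) s) (2 * p) 𝔄 ∈
      algebraicClasses (fiberOver ((baseChangeHom σ).map f₀) s) p :=
    cyclePart D hD hS (hR D hD) p _ h𝔄rat h𝔄hodge
  -- propagate from the `ℚ̄`-generic point `s` to `t` (P2c), then across `A.X ≅ 𝒳_t` (IsoInvariance, proved)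
  have ht := hP σ f₀ A.dim p hqp hirr hfam 𝔄 s hgen hs t
  have hA := anchorTransport_isoInvariance_proof eA p _ ht
  rwa [h𝔄c] at hA

/-- **Rational pVHC at genuine anchors of dimension `≥ m` from (⋆)-seeds on models of relative dimension
`≥ m`** (the engine `rationalPVHCFor_of_starSeedsFor` — P1a + BEK + P3a, by name — fed the seed statement
RESTRICTED to relative dimension `d ≥ m`; `m = 0` is `rationalPVHCAt_of_starSeedsAt` at the anchor).
[cite: BlochEsnaultKerz2014pAdic, Thm. 1.3] -/
theorem rationalPVHCFor_of_starSeeds_dim_ge (m : ℕ) (hP1a : FormalLiftingFromClassLifting)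
    (hP3a : FormalVectorBundlesAlgebraize)
    (h₂ : ∀ (p : ℕ) [Fact p.Prime] (k : Type) [Field k] [CharP k p] [PerfectRing k p] [IsAlgClosed k]
      (C : CrystallineRealization p k), C.BerthelotOgusLineBundleLifting → BlochEsnaultKerzLifting C →
      ∀ ⦃d : ℕ⦄ ⦃𝒴 : SchemeOver (WittVector p k)⦄ (A₀ : AbelianVariety k), m ≤ d →
        ModelHypotheses d 𝒴 → A₀.X = WittScheme.specialFibre 𝒴 → A₀.IsSupersingular →
        DivisorClassesAreChern C (WittScheme.specialFibre 𝒴) →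
        RationallyLefschetz C (WittScheme.specialFibre 𝒴) →
        LenstraZarhin1993_supersingular_lefschetzClasses_eq_top C.toWeilCohomology A₀ →
        StarSeedsFor C d 𝒴)
    ⦃n : ℕ⦄ ⦃X : SchemeOver ℂ⦄ (D : Anchor n X) (hn : m ≤ n) (hD : D.IsGenuine) :
    RationalPVHCFor D.C n D.𝒴 :=
  rationalPVHCFor_of_starSeedsFor hP1a hP3a D.C hD.bek (D.modelHypotheses hD)
    (h₂ D.p D.k D.C hD.lineBundles hD.bek D.A₀ hn (D.modelHypotheses hD) D.special_eq D.supersingular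
      hD.divisorClasses hD.rationallyLefschetz hD.lefschetz)

/-- **Engine-free threshold composition**: if HC is settled for abelian varieties of dimension `< m`
(cycle part, as a hypothesis), then inner-form anchors of abelian varieties of dimension `≥ m`, rational
pVHC at genuine anchors of dimension `≥ m`, and P2c give `HodgeAbelianVarieties`. [cite: Deligne2000, §1] -/
theorem hodgeAbelianVarieties_of_rationalPVHC_dim_ge (m : ℕ)
    (hlow : ∀ A : AbelianVariety ℂ, A.dim < m → HodgeConjectureFor A.dim A.X)
    (h₁ : ∀ A : AbelianVariety ℂ, m ≤ A.dim → InnerFormAnchorsFor A)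
    (hR : ∀ ⦃n : ℕ⦄ ⦃X : SchemeOver ℂ⦄ (D : Anchor n X), m ≤ n → D.IsGenuine → RationalPVHCFor D.C n D.𝒴)
    (hP : HodgeLocusPropagation) : HodgeAbelianVarieties := by
  intro A
  by_cases hm : m ≤ A.dim
  · exact hodgeConjectureFor_of_innerFormAnchorsFor A (h₁ A hm) (fun X D hD => hR D hm hD) hP
  · exact hlow A (by omega)

end Summit.HodgeConjecture.HodgeConjecture.Theorems.PadicSemiregularLift.AbelianAnchor

namespace Summit.HodgeConjecture.HodgeConjecture.Theorems

open Summit.HodgeConjecture.HodgeConjecture.Theses.PadicSemiregularLift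
open PadicSemiregularLift.AbelianAnchor

/-! ### The node from EXACTLY its two foreseen children -/

/-- **`AbelianAnchorAssembly` from its two foreseen typed children, nothing else**: inner-form anchors
`∀ A : AbelianVariety ℂ, InnerFormAnchorsFor A` (support, true in print) and (⋆)-seeds at every realization
`∀ p k … (C : CrystallineRealization p k), StarSeedsAt C` (crux). The third hypothesis of the landed glue
`abelianAnchorAssembly_of` (p89488), the Hodge-model fact, is discharged by `nonempty_hodgeModel_holds`.
[cite: BlochEsnaultKerz2014pAdic, Thm. 1.3] -/
theorem abelianAnchorAssembly_of_children
    (h₁ : ∀ A : Literature.AlgebraicGeometry.Motives.AbelianVariety ℂ, InnerFormAnchorsFor A)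
    (h₂ : ∀ (p : ℕ) [Fact p.Prime] (k : Type) [Field k] [CharP k p] [PerfectRing k p] [IsAlgClosed k]
      (C : Literature.AlgebraicGeometry.Motives.CrystallineRealization p k), StarSeedsAt C) :
    AbelianAnchorAssembly :=
  abelianAnchorAssembly_of h₁ h₂ (fun _ _ => nonempty_hodgeModel_holds)

/-- **Engine-free fallback from the children's weakest form**: inner-form anchors + rational pVHC in the
middle degrees at every realization (`RationalPVHCAt`) give the node (P1a, P3a idle), Hodge-model fact
discharged. [cite: Deligne2000, §1] -/
theorem abelianAnchorAssembly_of_rationalPVHC'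
    (h₁ : ∀ A : Literature.AlgebraicGeometry.Motives.AbelianVariety ℂ, InnerFormAnchorsFor A)
    (hR : ∀ (p : ℕ) [Fact p.Prime] (k : Type) [Field k] [CharP k p] [PerfectRing k p] [IsAlgClosed k]
      (C : Literature.AlgebraicGeometry.Motives.CrystallineRealization p k), RationalPVHCAt C) :
    AbelianAnchorAssembly :=
  abelianAnchorAssembly_of_rationalPVHC h₁ hR (fun _ _ => nonempty_hodgeModel_holds)

/-- **THE DIMENSION-SIX THRESHOLD**: granted Markman's Cor. 1.3 (`dim ≤ 5`, Literature fact), the node follows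
from inner-form anchors of abelian varieties of dimension `≥ 6` and (⋆)-seeds on supersingular
abelian-scheme models of relative dimension `≥ 6` ONLY (the seed statement `StarSeedsAt` with `6 ≤ d`
inserted); the engine P1a/P3a and P2c are consumed by name inside. This is the exact residual content the
split items of the node have to carry. [claim: Markman2025SurveySecant, status: under-review] -/
theorem abelianAnchorAssembly_of_children_dim_ge_six
    (h5 : Markman2025_hodgeClasses_algebraic_abelian_dim_le_five)
    (h₁ : ∀ A : Literature.AlgebraicGeometry.Motives.AbelianVariety ℂ, 6 ≤ A.dim → InnerFormAnchorsFor A)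
    (h₂ : ∀ (p : ℕ) [Fact p.Prime] (k : Type) [Field k] [CharP k p] [PerfectRing k p] [IsAlgClosed k]
      (C : Literature.AlgebraicGeometry.Motives.CrystallineRealization p k),
      C.BerthelotOgusLineBundleLifting → BlochEsnaultKerzLifting C →
      ∀ ⦃d : ℕ⦄ ⦃𝒴 : Literature.AlgebraicGeometry.Motives.SchemeOver (WittVector p k)⦄
        (A₀ : Literature.AlgebraicGeometry.Motives.AbelianVariety k), 6 ≤ d →
        ModelHypotheses d 𝒴 → A₀.X = Literature.AlgebraicGeometry.Motives.WittScheme.specialFibre 𝒴 →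
        A₀.IsSupersingular →
        DivisorClassesAreChern C (Literature.AlgebraicGeometry.Motives.WittScheme.specialFibre 𝒴) →
        RationallyLefschetz C (Literature.AlgebraicGeometry.Motives.WittScheme.specialFibre 𝒴) →
        Literature.AlgebraicGeometry.Motives.LenstraZarhin1993_supersingular_lefschetzClasses_eq_top
          C.toWeilCohomology A₀ →
        StarSeedsFor C d 𝒴) :
    AbelianAnchorAssembly :=
  fun hP hP1a hP3a => hodgeAbelianVarieties_of_rationalPVHC_dim_ge 6
    (fun A _ => hodgeConjectureFor_abelian_of_dim_le_five h5 (fun _ _ => nonempty_hodgeModel_holds) A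
      (by omega)) h₁
    (fun _ _ D hn hD => rationalPVHCFor_of_starSeeds_dim_ge 6 hP1a hP3a h₂ D hn hD) hP

/-- **Engine-free threshold `6`**: granted Markman's Cor. 1.3, inner-form anchors of abelian varieties of
dimension `≥ 6` and rational pVHC in the middle degrees at genuine anchors of dimension `≥ 6` give the node
(P1a, P3a idle; P2c by name). [claim: Markman2025SurveySecant, status: under-review] -/
theorem abelianAnchorAssembly_of_rationalPVHC_dim_ge_six
    (h5 : Markman2025_hodgeClasses_algebraic_abelian_dim_le_five)
    (h₁ : ∀ A : Literature.AlgebraicGeometry.Motives.AbelianVariety ℂ, 6 ≤ A.dim → InnerFormAnchorsFor A)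
    (hR : ∀ ⦃n : ℕ⦄ ⦃X : Literature.AlgebraicGeometry.Motives.SchemeOver ℂ⦄ (D : Anchor n X), 6 ≤ n →
      D.IsGenuine → RationalPVHCFor D.C n D.𝒴) :
    AbelianAnchorAssembly :=
  fun hP _ _ => hodgeAbelianVarieties_of_rationalPVHC_dim_ge 6
    (fun A _ => hodgeConjectureFor_abelian_of_dim_le_five h5 (fun _ _ => nonempty_hodgeModel_holds) A
      (by omega)) h₁ hR hP

/-- **Engine-free threshold `4` on classical input only**: granted the tree's fact
`hodgeClasses_algebraic_of_dim_le_three` (curves, surfaces, threefolds: Lefschetz `(1,1)` and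
`L : H² ≅ H⁴`, Voisin II §10.2.3), inner-form anchors of abelian varieties of dimension `≥ 4` and rational
pVHC at genuine anchors of dimension `≥ 4` give the node. [cite: VoisinHodgeII2003, §10.2.3 proof of Prop. 10.26] -/
theorem abelianAnchorAssembly_of_rationalPVHC_dim_ge_four (h3 : hodgeClasses_algebraic_of_dim_le_three)
    (h₁ : ∀ A : Literature.AlgebraicGeometry.Motives.AbelianVariety ℂ, 4 ≤ A.dim → InnerFormAnchorsFor A)
    (hR : ∀ ⦃n : ℕ⦄ ⦃X : Literature.AlgebraicGeometry.Motives.SchemeOver ℂ⦄ (D : Anchor n X), 4 ≤ n →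
      D.IsGenuine → RationalPVHCFor D.C n D.𝒴) :
    AbelianAnchorAssembly :=
  fun hP _ _ => hodgeAbelianVarieties_of_rationalPVHC_dim_ge 4
    (fun A _ => HodgeAbelianVarieties.Negative.of_dim_le_three h3 (fun _ _ => nonempty_hodgeModel_holds) A
      (by omega)) h₁ hR hP

/-! ### Logical status without the Hodge-model hypothesis -/

/-- **The crux is exactly its cycle part**, unconditionally (`HodgeAbelianVarieties.Negative.iff_cyclePart`
with `hM` discharged). [cite: Deligne2000, §1] -/
theorem hodgeAbelianVarieties_iff_cyclePart :
    HodgeAbelianVarieties ↔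
      ∀ (A : AbelianVariety ℂ) (p : ℕ) (c : singularCohomology ℂ ℂ (ComplexPoints A.X) (2 * p)),
        IsRationalClass c → IsOfHodgeType A.dim A.X (2 * p) p p c → c ∈ algebraicClasses A.X p :=
  HodgeAbelianVarieties.Negative.iff_cyclePart (fun _ _ => nonempty_hodgeModel_holds)

/-- **Granted the engine, the node is exactly the cycle part of HC on abelian varieties in the middle
codimensions** `1 ≤ p < dim A` — now with no fact hypothesis (`abelianAnchorAssembly_iff_middleCyclePart_of_engine`,
p89354, with `hM` discharged). [cite: Deligne2000, §1] -/
theorem abelianAnchorAssembly_iff_middleCyclePart_of_engine' (hP : HodgeLocusPropagation)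
    (h1a : FormalLiftingFromClassLifting) (h3a : FormalVectorBundlesAlgebraize) :
    AbelianAnchorAssembly ↔
      ∀ (A : AbelianVariety ℂ) (p : ℕ), 1 ≤ p → p < A.dim →
        ∀ c : singularCohomology ℂ ℂ (ComplexPoints A.X) (2 * p), IsRationalClass c →
          IsOfHodgeType A.dim A.X (2 * p) p p c → c ∈ algebraicClasses A.X p :=
  abelianAnchorAssembly_iff_middleCyclePart_of_engine hP h1a h3a (fun _ _ => nonempty_hodgeModel_holds)

/-- **The Hodge conjecture for complex abelian varieties of dimension `≤ 1` — unconditional** (points and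
elliptic curves: no middle codimension; the Hodge model exists by `nonempty_hodgeModel_holds`, the extreme
codimensions are algebraic by `HodgeAbelianVarieties.Negative.mem_algebraicClasses_of_dim_le`). The first
instances of the crux `HodgeAbelianVarieties` that are theorems of the tree with no hypothesis. [folklore] -/
theorem hodgeConjectureFor_abelian_of_dim_le_one (A : AbelianVariety ℂ) (hA : A.dim ≤ 1) :
    HodgeConjectureFor A.dim A.X :=
  abelianAnchorAssembly_inst_of_dim_le_one (fun _ _ => nonempty_hodgeModel_holds) A hA

/-- **Granted the engine and Markman's Cor. 1.3, the node is exactly the cycle part of HC for abelian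
varieties of dimension `≥ 6` in the middle codimensions** (`abelianAnchorAssembly_iff_dim_ge_six_of_engine`,
p95194, with `hM` discharged). [claim: Markman2025SurveySecant, status: under-review] -/
theorem abelianAnchorAssembly_iff_dim_ge_six_of_engine' (hP : HodgeLocusPropagation)
    (h1a : FormalLiftingFromClassLifting) (h3a : FormalVectorBundlesAlgebraize)
    (h5 : Markman2025_hodgeClasses_algebraic_abelian_dim_le_five) :
    AbelianAnchorAssembly ↔
      ∀ A : AbelianVariety ℂ, 6 ≤ A.dim → ∀ p : ℕ, 1 ≤ p → p < A.dim →
        ∀ c : singularCohomology ℂ ℂ (ComplexPoints A.X) (2 * p), IsRationalClass c →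
          IsOfHodgeType A.dim A.X (2 * p) p p c → c ∈ algebraicClasses A.X p :=
  abelianAnchorAssembly_iff_dim_ge_six_of_engine hP h1a h3a (fun _ _ => nonempty_hodgeModel_holds) h5

/-- **Conversely, HC for abelian varieties of dimension `≥ 6` alone gives the node** (engine idle), granted
Markman's Cor. 1.3 — `abelianAnchorAssembly_of_dim_ge_six` (p95194) with `hM` discharged.
[claim: Markman2025SurveySecant, status: under-review] -/
theorem abelianAnchorAssembly_of_dim_ge_six'
    (h5 : Markman2025_hodgeClasses_algebraic_abelian_dim_le_five)
    (h : ∀ A : AbelianVariety ℂ, 6 ≤ A.dim → HodgeConjectureFor A.dim A.X) : AbelianAnchorAssembly :=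
  abelianAnchorAssembly_of_dim_ge_six (fun _ _ => nonempty_hodgeModel_holds) h5 h

end Summit.HodgeConjecture.HodgeConjecture.Theorems

end
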